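import Literature.MathematicalPhysics.QuantumFieldTheory.Balaban1983to89.B9SectBKerFrameCodedY
import Literature.MathematicalPhysics.QuantumFieldTheory.Balaban1983to89.B6RandomWalkL2Hom
import Literature.MathematicalPhysics.QuantumFieldTheory.Balaban1983to89.B9SectBQSizesY

/-!
# `Balaban1983to89.B9SectBKerLettersL2Y` — (3.19)∕(3.24)∕(3.57) IN BLOCK-`ℓ²`, TWO CARRIERS, AT NODE 00's LETTERS: the structured `ℓ²` Hom-readings of
# `QcC = Q′(V)` (weight `w_c = W^{−1/2}`), `QcsC = Q′*(V)` (weight `w_s = W^{1/2}`), and of their (3.57) variations `FcC`, `FcsC` (× `c_var·β′`)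
# (pub-ymgap N06 row 13, G side, `L²` member: first brick of the `Read377L2` port — the fields `hQc2 ∕ hQcs2 ∕ hFc2 ∕ wc ∕ ws ∕ hprod` of g6's `L2GFrame₃`
# on the BLOCK carrier)

T. Bałaban, *Propagators for lattice gauge theories in a background field*, Commun. Math. Phys. **99** (1985) 389–434
[`Balaban1985BackgroundPropagators`, "B9"], (3.19) p. 393, (3.21)∕(3.24) pp. 394–395, (3.57)–(3.59) pp. 401–402; [4] = T. Bałaban, *Propagators and
renormalization transformations for lattice gauge theories. II*, Commun. Math. Phys. **96** (1984) 223–250 [`Balaban1984PropagatorsII`], (2.14)–(2.16) p. 225,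
(2.69) p. 235, Prop. 2.6 (2.140)–(2.141) p. 247.

statement-level skeleton of published theorems with citation tags; proofs where landed; nothing here is a claim about the Yang–Mills mass gap

WHY THIS FILE (seat dag-n06-c gen 14, READ377L2-PORT-PLAN F1).  The last displayed printed law of the `L²` member of row 13 (`Read377L2`, (3.77) in block-ℓ²)
is proved in g6's `B9SectBL2GStepAtLettersV3.read377_of_l2GFrame₃` on the SCALAR C carrier from structured two-carrier ℓ² readings of `Q′`, `Q′*` with weights
`w_c`, `w_s`, `w_s·w_c ≦ 1`.  At NODE 00 the C side lives on the block carrier `BlkY × ι`; this file supplies those readings there: §1 a generic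
two-carrier `ℓ²` dictionary through the basis coordinates (`hasL2MajorantHom_conjHom_of_indBound`, the Hom twin of `B9SectBL2GReadY.hasL2Majorant_conjB_of_indBound`);
§2 the weights `wcY y = W(β y)^{−1/2}`, `wsY y = W(β y)^{1/2}` (`W(s) = (Lʲ)^{d+1}`, [4] (2.69)), `wsY·wcY = 1`; §3 Schur's test for block averages ∕ block
extensions (`l2_indOf_le_of_blockAvg`: `Σ_z|q′(s,z)| ≦ 1`, `|q′(s,z)| ≦ W(s)⁻¹`; `l2_indOf_le_of_blockExt`: `#Δ(s) ≦ W(s)`); §4 ★★ `hasL2MajorantHom_QcC` ∕ `QcsC`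
((3.19)∕(3.24): kernels `c_L·𝟙[a = a′]·w_c(a)`, `c_L·𝟙[a = a′]·w_s(a)`), `hasL2MajorantHom_FcC` ∕ `FcsC` ((3.57)∕(3.59) under `VarParY`: × `c_var·β′`).

HONEST SCOPE.  Finite-dimensional bookkeeping over NODE 00's DEFINED block averages (`QpY`, `QpsY`, kernel `qpK = qB`) and the displayed site-transporter
variation law `VarParY`; no estimate of [B9] asserted.  COUNT-NEUTRAL; N06 NOT discharged; nothing continuum ∕ OS ∕ mass-gap ∕ Clay.  Cell `pub-ymgap` (HUMAN
RULING D-0062), Track A node N06 [B9], row 13, 2026-08-29.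
-/

noncomputable section

namespace Literature.MathematicalPhysics.QuantumFieldTheory.Balaban1983to89.B9SectBKerLettersL2Y

open B6Ineq2142KLevelV1 (β)
open B6Geom246MultiLevelBox (blkOf)
open B6Ineq268MultiLevelBox (W W_pos card_blkOf_le abs_qB)
open B6KLevelCensusIndexV1 (KIdx kGeo)
open B6RandomWalk (blockPiece)
open B6RandomWalkL2 (l2n l2n_sq l2n_nonneg l2n_mono l2n_sum_le l2n_smul)
open B6RandomWalkL2Hom (HasL2MajorantHom)
open B9Thm34Ext (toB6)
open B9GeoNormsKLevelV1 (geo9K)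
open B9Eq39Adjoint (R)
open B9Eq352DivFormLetters (coordEquiv coordEquiv_apply)
open B9Eq376POneLetters (conjHom conjHom_apply)
open B9Eq360DeltaPrimeAY (blkY blkY_apply AfldY)
open B9SectBGpLettersY (decY decY_base blkC)
open B9SectBGpReadingsY (coordEquiv_symm_eq_sum_liftY liftY_eq_liftY_unit)
open B9SectBCodedCarrier (CCfg)
open B9SectBKerLettersY (QcC QcsC FcC FcsC)
open B9SectBKerFrameCodedY (VarParY QpY_sub_apply)
open B9Thm39CinvSandwichQ (qpK_eq_qB sum_abs_qpK_le_one QpY_apply_eq_zero_of QpsY_apply)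
open B9Eq3104CutoffCommutatorSizes (qpK_ne_zero_imp)
open B9Eq360Vprime (norm_R_le_of_unit)
open B9SectBQSizesY (norm_real_smul_le)
open Node00 (SiteY BlkY IBondY CfgY SiteParY liftY liftY_apply l2OfY qpK qpT QpY QpsY trLiftY_apply)

variable {d ℓ : ℕ} {hd : 1 ≤ d + 1} {hL : Odd (ℓ + 1) ∧ 1 < ℓ + 1} {b₀ b₁ : ℝ}
variable {𝔸 : Type} [NormedRing 𝔸] [NormedAlgebra ℂ 𝔸] [CompleteSpace 𝔸]
variable {ι : Type} [Fintype ι]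

/-! ## §1 The two-carrier `ℓ²` dictionary through the basis coordinates -/

section Dictionary

variable {g : B9.Geometry} [Fintype g.Site] [DecidableEq g.Site] {Rr : ℝ} {Hp : Prop}
variable {X Y : Type} [Fintype X] [DecidableEq X] [Fintype Y] [DecidableEq Y] (b : Module.Basis ι ℝ 𝔸)

open Classical in
/-- the indicator of the fibre of the block map `blkY` over the block `y`. [cite: Balaban1984PropagatorsII, (2.51) p.232, bookkeeping] -/
def indOf (blkY : Y → g.Site) (y : g.Site) : Y → ℝ := fun v => if blkY v = y then 1 else 0

omit [NormedRing 𝔸] [NormedAlgebra ℂ 𝔸] [CompleteSpace 𝔸] [Fintype ι] [Fintype g.Site] [Fintype Y] [DecidableEq Y] in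
/-- the indicator on its fibre. [cite: Balaban1984PropagatorsII, (2.51) p.232, bookkeeping] -/
theorem indOf_of_eq {blkY : Y → g.Site} {y : g.Site} {v : Y} (h : blkY v = y) : indOf blkY y v = 1 := by
  unfold indOf; rw [if_pos h]

omit [NormedRing 𝔸] [NormedAlgebra ℂ 𝔸] [CompleteSpace 𝔸] [Fintype ι] [Fintype g.Site] [Fintype Y] [DecidableEq Y] in
/-- the indicator off its fibre. [cite: Balaban1984PropagatorsII, (2.51) p.232, bookkeeping] -/
theorem indOf_of_ne {blkY : Y → g.Site} {y : g.Site} {v : Y} (h : blkY v ≠ y) : indOf blkY y v = 0 := by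
  unfold indOf; rw [if_neg h]

omit [NormedAlgebra ℂ 𝔸] [CompleteSpace 𝔸] [Fintype ι] [DecidableEq Y] in
/-- the block `ℓ²` reading with cut-off `h` IS the `ℓ²` norm of `h·‖Ψ‖` (any finite carrier). [cite: Balaban1985BackgroundPropagators, (3.46) p.398, bookkeeping] -/
theorem l2OfY_eq_l2n (h : Y → ℝ) (Ψ : Y → 𝔸) : l2OfY h Ψ = l2n (fun q => h q * ‖Ψ q‖) := by
  unfold l2OfY l2n
  rw [EuclideanSpace.norm_eq]
  congr 1
  refine Finset.sum_congr rfl fun q _ => ?_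
  rw [Real.norm_eq_abs, sq_abs]

omit [NormedAlgebra ℂ 𝔸] [CompleteSpace 𝔸] [Fintype ι] [DecidableEq Y] in
/-- sub-additivity of the block `ℓ²` reading along finite sums for a nonnegative cut-off. [cite: Balaban1984PropagatorsII, (2.52) p.232, bookkeeping] -/
theorem l2OfY_sum_le {h : Y → ℝ} (hh : ∀ q, 0 ≤ h q) {β' : Type} (S : Finset β') (Ψ : β' → Y → 𝔸) :
    l2OfY h (∑ k ∈ S, Ψ k) ≤ ∑ k ∈ S, l2OfY h (Ψ k) := by
  rw [l2OfY_eq_l2n]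
  simp only [l2OfY_eq_l2n]
  refine le_trans (l2n_mono (v := ∑ k ∈ S, fun q => h q * ‖Ψ k q‖) fun q => ?_) (l2n_sum_le S _)
  rw [Finset.sum_apply, Finset.sum_apply, ← Finset.mul_sum, abs_of_nonneg (mul_nonneg (hh q) (norm_nonneg _)),
    abs_of_nonneg (mul_nonneg (hh q) (Finset.sum_nonneg fun k _ => norm_nonneg _))]
  exact mul_le_mul_of_nonneg_left (norm_sum_le _ _) (hh q)

omit [CompleteSpace 𝔸] [Fintype X] [DecidableEq X] [DecidableEq Y] in
/-- **THE `ℓ²` SIZE OF A `conjHom b` BLOCK PIECE** against the `𝔸`-valued block `ℓ²` reading on the target carrier: with coordinate constant `M₂`,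
`‖1_{y}·conjHom b T u‖₂ ≦ √|ι|·M₂·‖1_{y}·(T Λ_u)‖₂`, `Λ_u = coord⁻¹ u`. [cite: Balaban1984PropagatorsII, (2.51)–(2.52) p.232; Balaban1985BackgroundPropagators, (3.39) p.397] -/
theorem l2n_blockPiece_conjHom_le (blkY : Y → g.Site) {M₂ : ℝ} (hM₂ : 0 ≤ M₂) (hrepr : ∀ (v : 𝔸) (j : ι), |b.repr v j| ≤ M₂ * ‖v‖)
    (T : (X → 𝔸) →ₗ[ℝ] (Y → 𝔸)) (u : X × ι → ℝ) (y : g.Site) :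
    l2n (blockPiece (g := toB6 g Rr Hp) (fun q : Y × ι => blkY q.1) y (conjHom b T u)) ≤
      Real.sqrt (Fintype.card ι) * M₂ * l2OfY (indOf blkY y) (T ((coordEquiv b).symm u)) := by
  have hrhs : 0 ≤ Real.sqrt (Fintype.card ι) * M₂ * l2OfY (indOf blkY y) (T ((coordEquiv b).symm u)) := by
    unfold l2OfY; positivity
  refine (pow_le_pow_iff_left₀ (l2n_nonneg _) hrhs two_ne_zero).1 ?_
  rw [l2n_sq, mul_pow, mul_pow, Real.sq_sqrt (Nat.cast_nonneg _), l2OfY, Real.sq_sqrt (Finset.sum_nonneg fun _ _ => sq_nonneg _),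
    Fintype.sum_prod_type, Finset.mul_sum]
  refine Finset.sum_le_sum fun z _ => ?_
  by_cases hz : blkY z = y
  · rw [indOf_of_eq hz, one_mul]
    calc ∑ j, (blockPiece (g := toB6 g Rr Hp) (fun q : Y × ι => blkY q.1) y (conjHom b T u)) (z, j) ^ 2
        = ∑ j, (b.repr (T ((coordEquiv b).symm u) z) j) ^ 2 := by
          refine Finset.sum_congr rfl fun j _ => ?_
          rw [blockPiece]
          dsimp only
          split_ifs with hc
          · rw [conjHom_apply]
          · exact absurd hz hc
      _ ≤ ∑ _j : ι, (M₂ * ‖T ((coordEquiv b).symm u) z‖) ^ 2 :=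
          Finset.sum_le_sum fun j _ => by
            have h := hrepr (T ((coordEquiv b).symm u) z) j
            have h0 : 0 ≤ M₂ * ‖T ((coordEquiv b).symm u) z‖ := mul_nonneg hM₂ (norm_nonneg _)
            nlinarith [abs_nonneg (b.repr (T ((coordEquiv b).symm u) z) j), sq_abs (b.repr (T ((coordEquiv b).symm u) z) j)]
      _ = (Fintype.card ι : ℝ) * M₂ ^ 2 * ‖T ((coordEquiv b).symm u) z‖ ^ 2 := by
          rw [Finset.sum_const, Finset.card_univ, nsmul_eq_mul]; ring
  · have h0 : ∀ j, blockPiece (g := toB6 g Rr Hp) (fun q : Y × ι => blkY q.1) y (conjHom b T u) (z, j) = 0 := fun j => by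
      rw [blockPiece]
      dsimp only
      split_ifs with hc
      · exact absurd hc hz
      · rfl
    simp only [h0]
    rw [zero_pow two_ne_zero, Finset.sum_const_zero]
    positivity

omit [NormedRing 𝔸] [NormedAlgebra ℂ 𝔸] [CompleteSpace 𝔸] [DecidableEq X] in
/-- a scaled column slice of `u : X × ι → ℝ` has `ℓ²` norm `≦ |c|·‖u‖₂`. [cite: Balaban1984PropagatorsII, (2.51) p.232, bookkeeping] -/
theorem sqrt_sum_col_sq_le (u : X × ι → ℝ) (j : ι) (c : ℝ) : Real.sqrt (∑ x, (c * u (x, j)) ^ 2) ≤ |c| * l2n u := by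
  have hcol : ∑ x, u (x, j) ^ 2 ≤ l2n u ^ 2 := by
    rw [l2n_sq, Fintype.sum_prod_type]
    exact Finset.sum_le_sum fun x _ => Finset.single_le_sum (f := fun j' => u (x, j') ^ 2) (fun _ _ => sq_nonneg _) (Finset.mem_univ j)
  have hc : ∑ x, (c * u (x, j)) ^ 2 = c ^ 2 * ∑ x, u (x, j) ^ 2 := by
    rw [Finset.mul_sum]; exact Finset.sum_congr rfl fun x _ => by ring
  rw [hc, Real.sqrt_mul (sq_nonneg c), Real.sqrt_sq_eq_abs]
  refine mul_le_mul_of_nonneg_left ?_ (abs_nonneg c)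
  calc Real.sqrt (∑ x, u (x, j) ^ 2) ≤ Real.sqrt (l2n u ^ 2) := Real.sqrt_le_sqrt hcol
    _ = l2n u := Real.sqrt_sq (l2n_nonneg u)

omit [CompleteSpace 𝔸] [DecidableEq X] [DecidableEq Y] in
/-- ★ **TWO-CARRIER READING ⇒ `ℓ²` Hom-MAJORANT** ([4] (2.140) through coordinates): if the `ℝ`-letter `T : (X → 𝔸) → (Y → 𝔸)` satisfies, for every
product-form input `J ⊗ E` with `‖E‖ ≦ 1` and `J` supported in the `blkX`-fibre of `y′`, the block-`ℓ²` bound `‖1_{y}·T(J ⊗ E)‖₂ ≦ K(y,y′)·‖J‖₂` (`K ≧ 0`),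
then `conjHom b T` has the two-carrier block-`ℓ²` majorant `c_L·K`, `c_L = √|ι|·M₂·Σ_j‖b_j‖`.
[cite: Balaban1984PropagatorsII, Prop. 2.6 (2.140)–(2.141) p.247, (2.51)–(2.52) p.232; Balaban1985BackgroundPropagators, (3.39) p.397] -/
theorem hasL2MajorantHom_conjHom_of_indBound (blkX : X → g.Site) (blkY : Y → g.Site) {M₂ : ℝ} (hM₂ : 0 ≤ M₂)
    (hrepr : ∀ (v : 𝔸) (j : ι), |b.repr v j| ≤ M₂ * ‖v‖) (T : (X → 𝔸) →ₗ[ℝ] (Y → 𝔸)) (K : g.Site → g.Site → ℝ) (hK : ∀ a a', 0 ≤ K a a')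
    (hT : ∀ (J : X → ℝ) (E : 𝔸) (y y' : g.Site), ‖E‖ ≤ 1 → (∀ x, blkX x ≠ y' → J x = 0) →
      l2OfY (indOf blkY y) (T (liftY J E)) ≤ K y y' * Real.sqrt (∑ x, J x ^ 2)) :
    HasL2MajorantHom (g := toB6 g Rr Hp) (fun p : X × ι => blkX p.1) (fun q : Y × ι => blkY q.1) (conjHom b T)
      (fun a a' => (Real.sqrt (Fintype.card ι) * M₂ * ∑ j, ‖b j‖) * K a a') := by
  classical
  intro y y' u hu
  have hind : ∀ q, 0 ≤ indOf blkY y q := fun q => by unfold indOf; split_ifs <;> norm_num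
  have h1 := l2n_blockPiece_conjHom_le (Rr := Rr) (Hp := Hp) b blkY hM₂ hrepr T u y
  have hne : ∀ j, ‖b j‖ ≠ 0 := fun j => norm_ne_zero_iff.2 (b.ne_zero j)
  set uj : ι → X → ℝ := fun j x => ‖b j‖ * u (x, j) with huj
  set Ej : ι → 𝔸 := fun j => (‖b j‖⁻¹ : ℝ) • b j with hEj
  have hEj1 : ∀ j, ‖Ej j‖ ≤ 1 := fun j => by
    rw [hEj]; dsimp only
    rw [norm_smul, norm_inv, Real.norm_eq_abs, abs_norm, inv_mul_cancel₀ (hne j)]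
  have hΛ : (coordEquiv b).symm u = ∑ j, liftY (uj j) (Ej j) := by
    rw [coordEquiv_symm_eq_sum_liftY b u]
    exact Finset.sum_congr rfl fun j _ => liftY_eq_liftY_unit _ (b.ne_zero j)
  have hTΛ : T ((coordEquiv b).symm u) = ∑ j, T (liftY (uj j) (Ej j)) := by rw [hΛ, map_sum]
  have h2 : l2OfY (indOf blkY y) (T ((coordEquiv b).symm u)) ≤ ∑ j, l2OfY (indOf blkY y) (T (liftY (uj j) (Ej j))) := by
    rw [hTΛ]; exact l2OfY_sum_le hind Finset.univ _
  have h3 : ∀ j, l2OfY (indOf blkY y) (T (liftY (uj j) (Ej j))) ≤ K y y' * (‖b j‖ * l2n u) := by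
    intro j
    have hoff : ∀ x, blkX x ≠ y' → uj j x = 0 := fun x hx => by
      rw [huj]; dsimp only; rw [hu (x, j) hx, mul_zero]
    refine (hT (uj j) (Ej j) y y' (hEj1 j) hoff).trans (mul_le_mul_of_nonneg_left ?_ (hK y y'))
    exact (sqrt_sum_col_sq_le u j ‖b j‖).trans (by rw [abs_norm])
  have hSb : 0 ≤ ∑ j, ‖b j‖ := Finset.sum_nonneg fun _ _ => norm_nonneg _
  calc l2n (blockPiece (g := toB6 g Rr Hp) (fun q : Y × ι => blkY q.1) y (conjHom b T u))
      ≤ Real.sqrt (Fintype.card ι) * M₂ * l2OfY (indOf blkY y) (T ((coordEquiv b).symm u)) := h1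
    _ ≤ Real.sqrt (Fintype.card ι) * M₂ * ∑ j, K y y' * (‖b j‖ * l2n u) :=
        mul_le_mul_of_nonneg_left (h2.trans (Finset.sum_le_sum fun j _ => h3 j)) (by positivity)
    _ = (Real.sqrt (Fintype.card ι) * M₂ * ∑ j, ‖b j‖) * K y y' * l2n u := by
        rw [← Finset.mul_sum, ← Finset.sum_mul]; ring

end Dictionary

/-! ## §2 The weights `w_c = W^{−1/2}`, `w_s = W^{1/2}` on the labelled blocks -/

section Weights

variable (i : KIdx d ℓ hd hL b₀ b₁) (ιB : BlkY i → IBondY i)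

/-- `w_c(y) = W(β y)^{−1/2}` (`W(s) = (Lʲ⁽ˢ⁾)^{d+1} ≥ #Δ(s)`). [cite: Balaban1984PropagatorsII, (2.69) p.235, (2.141) p.247; Balaban1985BackgroundPropagators, (3.19) p.393] -/
def wcY (y : IBondY i) : ℝ := (Real.sqrt (W i.D.toDomains (β i.hN i.D i.hk y)))⁻¹

/-- `w_s(y) = W(β y)^{1/2}`. [cite: Balaban1984PropagatorsII, (2.69) p.235, (2.141) p.247; Balaban1985BackgroundPropagators, (3.24) p.395] -/
def wsY (y : IBondY i) : ℝ := Real.sqrt (W i.D.toDomains (β i.hN i.D i.hk y))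

omit [NormedRing 𝔸] [NormedAlgebra ℂ 𝔸] [CompleteSpace 𝔸] [Fintype ι] in
/-- `w_c ≥ 0`. [cite: Balaban1984PropagatorsII, (2.69) p.235, bookkeeping] -/
theorem wcY_nonneg (y : IBondY i) : 0 ≤ wcY i y := inv_nonneg.2 (Real.sqrt_nonneg _)

omit [NormedRing 𝔸] [NormedAlgebra ℂ 𝔸] [CompleteSpace 𝔸] [Fintype ι] in
/-- `w_s ≥ 0`. [cite: Balaban1984PropagatorsII, (2.69) p.235, bookkeeping] -/
theorem wsY_nonneg (y : IBondY i) : 0 ≤ wsY i y := Real.sqrt_nonneg _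

omit [NormedRing 𝔸] [NormedAlgebra ℂ 𝔸] [CompleteSpace 𝔸] [Fintype ι] in
/-- `w_s·w_c = 1` (so `≦ 1`, the law `hprod`). [cite: Balaban1984PropagatorsII, (2.69) p.235, (2.141) p.247, bookkeeping] -/
theorem wsY_mul_wcY (y : IBondY i) : wsY i y * wcY i y = 1 := by
  unfold wsY wcY
  exact mul_inv_cancel₀ (Real.sqrt_ne_zero'.2 (W_pos _ _))

omit [NormedRing 𝔸] [NormedAlgebra ℂ 𝔸] [CompleteSpace 𝔸] [Fintype ι] in
/-- `w_c(y)² = W(β y)⁻¹`. [cite: Balaban1984PropagatorsII, (2.69) p.235, bookkeeping] -/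
theorem wcY_sq (y : IBondY i) : wcY i y ^ 2 = (W i.D.toDomains (β i.hN i.D i.hk y))⁻¹ := by
  unfold wcY; rw [inv_pow, Real.sq_sqrt (W_pos _ _).le]

omit [NormedRing 𝔸] [NormedAlgebra ℂ 𝔸] [CompleteSpace 𝔸] [Fintype ι] in
/-- `w_s(y)² = W(β y)`. [cite: Balaban1984PropagatorsII, (2.69) p.235, bookkeeping] -/
theorem wsY_sq (y : IBondY i) : wsY i y ^ 2 = W i.D.toDomains (β i.hN i.D i.hk y) := by
  unfold wsY; rw [Real.sq_sqrt (W_pos _ _).le]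

omit [NormedRing 𝔸] [NormedAlgebra ℂ 𝔸] [CompleteSpace 𝔸] [Fintype ι] in
/-- the labelling is a section of `β`: `ι_B s = y ⟹ s = β y`. [cite: Balaban1984PropagatorsII, (2.45)–(2.46) p.231, bookkeeping] -/
theorem eq_beta_of_label (hι : ∀ s : BlkY i, β i.hN i.D i.hk (ιB s) = s) {s : BlkY i} {y : IBondY i} (h : ιB s = y) :
    s = β i.hN i.D i.hk y := by rw [← h, hι]

omit [NormedRing 𝔸] [NormedAlgebra ℂ 𝔸] [CompleteSpace 𝔸] [Fintype ι] in
/-- `|q′(s, z)| ≦ W(s)⁻¹`. [cite: Balaban1984PropagatorsII, (2.14) p.225, (2.69) p.235] -/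
theorem abs_qpK_le (s : BlkY i) (z : SiteY i) : |qpK i s z| ≤ (W i.D.toDomains s)⁻¹ := by
  rw [qpK_eq_qB, abs_qB]
  split_ifs
  · exact le_rfl
  · exact inv_nonneg.2 (W_pos _ _).le

omit [NormedRing 𝔸] [NormedAlgebra ℂ 𝔸] [CompleteSpace 𝔸] [Fintype ι] in
/-- `#Δ(s) ≦ W(s)` as a sum of an indicator. [cite: Balaban1984PropagatorsII, (2.14) p.225, (2.69) p.235] -/
theorem sum_ind_blkY_le (s : BlkY i) : ∑ z : SiteY i, (if blkY i z = s then (1 : ℝ) else 0) ≤ W i.D.toDomains s := by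
  classical
  rw [Finset.sum_ite, Finset.sum_const_zero, add_zero, Finset.sum_const, nsmul_eq_mul, mul_one]
  exact card_blkOf_le i.D.toDomains s

end Weights

/-! ## §3 Schur's test for block averages (site → block) and block extensions (block → site) -/

section Schur

variable (i : KIdx d ℓ hd hL b₀ b₁) (ιB : BlkY i → IBondY i) [DecidableEq (geo9K i).Site]

omit [CompleteSpace 𝔸] [Fintype ι] in
/-- ★★ **SCHUR, BLOCK AVERAGES**: an `ℝ`-letter `T : (SiteY → 𝔸) → (BlkY → 𝔸)` with `‖(TΛ)(s)‖ ≦ c·Σ_z |q′(s,z)|·‖Λ z‖` satisfies, for `J ⊗ E` with `‖E‖ ≦ 1`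
and `J` supported in the sites of the block labelled `y′`, `‖1_{y}·T(J ⊗ E)‖₂ ≦ 𝟙[y = y′]·c·w_c(y)·‖J‖₂` (`Σ_z|q′(s,z)| ≦ 1`, `|q′| ≦ W⁻¹`, Cauchy–Schwarz).
[cite: Balaban1985BackgroundPropagators, (3.19) p.393, (3.21) p.394; Balaban1984PropagatorsII, (2.14) p.225, Prop. 2.6 (2.141) p.247] -/
theorem l2_indOf_le_of_blockAvg (hι : ∀ s : BlkY i, β i.hN i.D i.hk (ιB s) = s) {T : (SiteY i → 𝔸) →ₗ[ℝ] (BlkY i → 𝔸)} {c : ℝ} (hc : 0 ≤ c)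
    (hT : ∀ (Λ : SiteY i → 𝔸) (s : BlkY i), ‖T Λ s‖ ≤ c * ∑ z, |qpK i s z| * ‖Λ z‖)
    (J : SiteY i → ℝ) (E : 𝔸) (y y' : IBondY i) (hE : ‖E‖ ≤ 1) (hJ : ∀ z, blkC i ιB z ≠ y' → J z = 0) :
    l2OfY (indOf (g := geo9K i) ιB y) (T (liftY J E)) ≤ (if y = y' then c * wcY i y else 0) * Real.sqrt (∑ z, J z ^ 2) := by
  classical
  set Λ : SiteY i → 𝔸 := liftY J E with hΛ
  have hΛf : ∀ z, ‖Λ z‖ ≤ |J z| := fun z => by rw [hΛ, liftY_apply]; exact norm_real_smul_le hE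
  have hJ0 : 0 ≤ ∑ z, J z ^ 2 := Finset.sum_nonneg fun _ _ => sq_nonneg _
  -- pointwise Cauchy–Schwarz at a block `s`: `‖TΛ(s)‖² ≤ c²·Σ_z |q′(s,z)|·J(z)²`
  have hpt : ∀ s, ‖T Λ s‖ ^ 2 ≤ c ^ 2 * ∑ z, |qpK i s z| * J z ^ 2 := by
    intro s
    have hn' : ‖T Λ s‖ ≤ c * ∑ z, |qpK i s z| * |J z| :=
      (hT Λ s).trans (mul_le_mul_of_nonneg_left (Finset.sum_le_sum fun z _ => mul_le_mul_of_nonneg_left (hΛf z) (abs_nonneg _)) hc)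
    have hCS : (∑ z, |qpK i s z| * |J z|) ^ 2 ≤ (∑ z, |qpK i s z|) * ∑ z, |qpK i s z| * J z ^ 2 :=
      Finset.sum_sq_le_sum_mul_sum_of_sq_le_mul _ (fun z _ => abs_nonneg _) (fun z _ => mul_nonneg (abs_nonneg _) (sq_nonneg _))
        fun z _ => by rw [mul_pow, sq_abs (J z)]; exact le_of_eq (by ring)
    have hM0 : 0 ≤ c * ∑ z, |qpK i s z| * |J z| := mul_nonneg hc (Finset.sum_nonneg fun z _ => by positivity)
    have hG0 : 0 ≤ ∑ z, |qpK i s z| * J z ^ 2 := Finset.sum_nonneg fun z _ => by positivity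
    calc ‖T Λ s‖ ^ 2 ≤ (c * ∑ z, |qpK i s z| * |J z|) ^ 2 := pow_le_pow_left₀ (norm_nonneg _) hn' 2
      _ = c ^ 2 * (∑ z, |qpK i s z| * |J z|) ^ 2 := mul_pow _ _ _
      _ ≤ c ^ 2 * ((∑ z, |qpK i s z|) * ∑ z, |qpK i s z| * J z ^ 2) := mul_le_mul_of_nonneg_left hCS (sq_nonneg _)
      _ ≤ c ^ 2 * (1 * ∑ z, |qpK i s z| * J z ^ 2) :=
          mul_le_mul_of_nonneg_left (mul_le_mul_of_nonneg_right (sum_abs_qpK_le_one i s) hG0) (sq_nonneg _)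
      _ = c ^ 2 * ∑ z, |qpK i s z| * J z ^ 2 := by rw [one_mul]
  rw [l2OfY]
  by_cases hyy : y = y'
  · subst hyy
    rw [if_pos rfl]
    have hK0 : 0 ≤ c * wcY i y := mul_nonneg hc (wcY_nonneg i y)
    -- only the block `β y` carries the indicator; there `|q′| ≤ W⁻¹`
    have hS : ∑ s, (indOf (g := geo9K i) ιB y s * ‖T Λ s‖) ^ 2 ≤ (c * wcY i y) ^ 2 * ∑ z, J z ^ 2 := by
      rw [Finset.sum_eq_single (β i.hN i.D i.hk y)]
      · by_cases hs : ιB (β i.hN i.D i.hk y) = y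
        · rw [indOf_of_eq hs, one_mul, mul_pow, wcY_sq]
          refine (hpt _).trans ?_
          rw [mul_assoc]
          refine mul_le_mul_of_nonneg_left ?_ (sq_nonneg _)
          rw [Finset.mul_sum]
          exact Finset.sum_le_sum fun z _ => mul_le_mul_of_nonneg_right (abs_qpK_le i _ z) (sq_nonneg _)
        · rw [indOf_of_ne hs, zero_mul, zero_pow two_ne_zero]; positivity
      · intro s _ hs
        have hne : ιB s ≠ y := fun h => hs (eq_beta_of_label i ιB hι h)
        rw [indOf_of_ne hne, zero_mul, zero_pow two_ne_zero]
      · intro h; exact absurd (Finset.mem_univ _) h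
    calc Real.sqrt (∑ s, (indOf (g := geo9K i) ιB y s * ‖T Λ s‖) ^ 2) ≤ Real.sqrt ((c * wcY i y) ^ 2 * ∑ z, J z ^ 2) := Real.sqrt_le_sqrt hS
      _ = c * wcY i y * Real.sqrt (∑ z, J z ^ 2) := by rw [Real.sqrt_mul (sq_nonneg _), Real.sqrt_sq hK0]
  · rw [if_neg hyy, zero_mul]
    -- every term vanishes: a block labelled `y` averages only sites whose block is labelled `y ≠ y′`, where `J = 0`
    have hS : ∑ s, (indOf (g := geo9K i) ιB y s * ‖T Λ s‖) ^ 2 = 0 := Finset.sum_eq_zero fun s _ => by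
      by_cases hs : ιB s = y
      · have h0 : ∑ z, |qpK i s z| * J z ^ 2 = 0 := Finset.sum_eq_zero fun z _ => by
          by_cases hq : qpK i s z = 0
          · rw [hq, abs_zero, zero_mul]
          · have hz : blkOf i.D.toDomains z = s := qpK_ne_zero_imp i hq
            have hJz : J z = 0 := hJ z fun h => hyy (by rw [← hs, ← h]; show ιB s = ιB (blkY i z); rw [blkY_apply, hz])
            rw [hJz, zero_pow two_ne_zero, mul_zero]
        have hT0 : ‖T Λ s‖ ^ 2 ≤ 0 := by have := hpt s; rw [h0, mul_zero] at this; exact this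
        have : ‖T Λ s‖ = 0 := by nlinarith [norm_nonneg (T Λ s), sq_nonneg ‖T Λ s‖]
        rw [this, mul_zero, zero_pow two_ne_zero]
      · rw [indOf_of_ne hs, zero_mul, zero_pow two_ne_zero]
    rw [hS, Real.sqrt_zero]

omit [CompleteSpace 𝔸] [Fintype ι] in
/-- ★★ **SCHUR, BLOCK EXTENSIONS**: an `ℝ`-letter `T : (BlkY → 𝔸) → (SiteY → 𝔸)` with `‖(TΛ)(z)‖ ≦ c·‖Λ(s_z)‖` (`s_z` the block of `z`) satisfies, for
`J ⊗ E` with `‖E‖ ≦ 1` and `J` supported on the block labelled `y′`, `‖1_{Δ(y)}·T(J ⊗ E)‖₂ ≦ 𝟙[y = y′]·c·w_s(y)·‖J‖₂` (`#Δ(s) ≦ W(s)`).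
[cite: Balaban1985BackgroundPropagators, (3.24)–(3.25) p.395; Balaban1984PropagatorsII, (2.16) p.225, Prop. 2.6 (2.141) p.247] -/
theorem l2_indOf_le_of_blockExt (hι : ∀ s : BlkY i, β i.hN i.D i.hk (ιB s) = s) {T : (BlkY i → 𝔸) →ₗ[ℝ] (SiteY i → 𝔸)} {c : ℝ} (hc : 0 ≤ c)
    (hT : ∀ (Λ : BlkY i → 𝔸) (z : SiteY i), ‖T Λ z‖ ≤ c * ‖Λ (blkY i z)‖)
    (J : BlkY i → ℝ) (E : 𝔸) (y y' : IBondY i) (hE : ‖E‖ ≤ 1) (hJ : ∀ s, ιB s ≠ y' → J s = 0) :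
    l2OfY (indOf (g := geo9K i) (blkC i ιB) y) (T (liftY J E)) ≤ (if y = y' then c * wsY i y else 0) * Real.sqrt (∑ s, J s ^ 2) := by
  classical
  set Λ : BlkY i → 𝔸 := liftY J E with hΛ
  have hΛf : ∀ s, ‖Λ s‖ ≤ |J s| := fun s => by rw [hΛ, liftY_apply]; exact norm_real_smul_le hE
  have hpt : ∀ z, ‖T Λ z‖ ^ 2 ≤ c ^ 2 * J (blkY i z) ^ 2 := fun z => by
    have h := (hT Λ z).trans (mul_le_mul_of_nonneg_left (hΛf _) hc)
    calc ‖T Λ z‖ ^ 2 ≤ (c * |J (blkY i z)|) ^ 2 := pow_le_pow_left₀ (norm_nonneg _) h 2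
      _ = c ^ 2 * J (blkY i z) ^ 2 := by rw [mul_pow, sq_abs]
  rw [l2OfY]
  by_cases hyy : y = y'
  · subst hyy
    rw [if_pos rfl]
    have hK0 : 0 ≤ c * wsY i y := mul_nonneg hc (wsY_nonneg i y)
    have hS : ∑ z, (indOf (g := geo9K i) (blkC i ιB) y z * ‖T Λ z‖) ^ 2 ≤ (c * wsY i y) ^ 2 * ∑ s, J s ^ 2 := by
      -- termwise: nonzero only on the sites of `β y`, each `≤ c²·J(β y)²`; their number is `≤ W(β y)`
      have hterm : ∀ z, (indOf (g := geo9K i) (blkC i ιB) y z * ‖T Λ z‖) ^ 2 ≤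
          (if blkY i z = β i.hN i.D i.hk y then (1 : ℝ) else 0) * (c ^ 2 * J (β i.hN i.D i.hk y) ^ 2) := by
        intro z
        by_cases hz : blkC i ιB z = y
        · have hb : blkY i z = β i.hN i.D i.hk y := eq_beta_of_label i ιB hι hz
          rw [indOf_of_eq hz, one_mul, if_pos hb, one_mul, ← hb]
          exact hpt z
        · rw [indOf_of_ne hz, zero_mul, zero_pow two_ne_zero]
          split_ifs <;> positivity
      calc ∑ z, (indOf (g := geo9K i) (blkC i ιB) y z * ‖T Λ z‖) ^ 2
          ≤ ∑ z, (if blkY i z = β i.hN i.D i.hk y then (1 : ℝ) else 0) * (c ^ 2 * J (β i.hN i.D i.hk y) ^ 2) :=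
            Finset.sum_le_sum fun z _ => hterm z
        _ = (∑ z, (if blkY i z = β i.hN i.D i.hk y then (1 : ℝ) else 0)) * (c ^ 2 * J (β i.hN i.D i.hk y) ^ 2) := by rw [Finset.sum_mul]
        _ ≤ W i.D.toDomains (β i.hN i.D i.hk y) * (c ^ 2 * J (β i.hN i.D i.hk y) ^ 2) :=
            mul_le_mul_of_nonneg_right (sum_ind_blkY_le i _) (by positivity)
        _ = (c * wsY i y) ^ 2 * J (β i.hN i.D i.hk y) ^ 2 := by rw [mul_pow, wsY_sq]; ring
        _ ≤ (c * wsY i y) ^ 2 * ∑ s, J s ^ 2 :=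
            mul_le_mul_of_nonneg_left (Finset.single_le_sum (f := fun s => J s ^ 2) (fun _ _ => sq_nonneg _) (Finset.mem_univ _)) (sq_nonneg _)
    calc Real.sqrt (∑ z, (indOf (g := geo9K i) (blkC i ιB) y z * ‖T Λ z‖) ^ 2) ≤ Real.sqrt ((c * wsY i y) ^ 2 * ∑ s, J s ^ 2) := Real.sqrt_le_sqrt hS
      _ = c * wsY i y * Real.sqrt (∑ s, J s ^ 2) := by rw [Real.sqrt_mul (sq_nonneg _), Real.sqrt_sq hK0]
  · rw [if_neg hyy, zero_mul]
    have hS : ∑ z, (indOf (g := geo9K i) (blkC i ιB) y z * ‖T Λ z‖) ^ 2 = 0 := Finset.sum_eq_zero fun z _ => by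
      by_cases hz : blkC i ιB z = y
      · have hJz : J (blkY i z) = 0 := hJ _ fun h => hyy (by rw [← hz, ← h]; rfl)
        have hT0 : ‖T Λ z‖ ^ 2 ≤ 0 := by have := hpt z; rw [hJz, zero_pow two_ne_zero, mul_zero] at this; exact this
        have : ‖T Λ z‖ = 0 := by nlinarith [norm_nonneg (T Λ z), sq_nonneg ‖T Λ z‖]
        rw [this, mul_zero, zero_pow two_ne_zero]
      · rw [indOf_of_ne hz, zero_mul, zero_pow two_ne_zero]
    rw [hS, Real.sqrt_zero]

end Schur

/-! ## §4 ★★ The structured two-carrier `ℓ²` readings of `QcC`, `QcsC`, `FcC`, `FcsC` -/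

section Readings

variable (i : KIdx d ℓ hd hL b₀ b₁) (par : SiteParY 𝔸 i) (b : Module.Basis ι ℝ 𝔸) (ιB : BlkY i → IBondY i)
  [Fintype (geo9K i).Site] [DecidableEq (geo9K i).Site] {Rr : ℝ} {Hp : Prop}

omit [Fintype (geo9K i).Site] [DecidableEq (geo9K i).Site] in
/-- `‖(Q′(U)Λ)(s)‖ ≦ Σ_z |q′(s,z)|·‖Λ z‖` (contractive transporters). [cite: Balaban1985BackgroundPropagators, (3.21) p.394; Balaban1984PropagatorsII, (2.14) p.225] -/
theorem norm_QpY_apply_le_sum {U : CfgY 𝔸 i} (hparU : ∀ z w : SiteY i, ‖(par U z w : 𝔸)‖ ≤ 1 ∧ ‖(((par U z w)⁻¹ : 𝔸ˣ) : 𝔸)‖ ≤ 1)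
    (Λ : SiteY i → 𝔸) (s : BlkY i) : ‖QpY i par U Λ s‖ ≤ ∑ z, |qpK i s z| * ‖Λ z‖ := by
  rw [QpY, trLiftY_apply]
  refine (norm_sum_le _ _).trans (Finset.sum_le_sum fun z _ => ?_)
  rw [norm_smul, Complex.norm_real, Real.norm_eq_abs]
  exact mul_le_mul_of_nonneg_left (norm_R_le_of_unit _ _ (hparU _ _)) (abs_nonneg _)

/-- ★★ **(3.19) IN BLOCK-`ℓ²`, TWO CARRIERS: `QcC (base U) ≺₂ c_L·𝟙[a = a′]·w_c(a)`** from the site carrier (`(z, j) ↦ ι_B(s_z)`) to the block carrier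
(`(s, j) ↦ ι_B s`), at a base with contractive site transporters. [cite: Balaban1985BackgroundPropagators, (3.19) p.393, (3.21) p.394; Balaban1984PropagatorsII, (2.14) p.225, Prop. 2.6 (2.141) p.247] -/
theorem hasL2MajorantHom_QcC (hι : ∀ s : BlkY i, β i.hN i.D i.hk (ιB s) = s) {M₂ : ℝ} (hM₂ : 0 ≤ M₂)
    (hrepr : ∀ (v : 𝔸) (j : ι), |b.repr v j| ≤ M₂ * ‖v‖) {U : CfgY 𝔸 i}
    (hparU : ∀ z w : SiteY i, ‖(par U z w : 𝔸)‖ ≤ 1 ∧ ‖(((par U z w)⁻¹ : 𝔸ˣ) : 𝔸)‖ ≤ 1) :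
    HasL2MajorantHom (g := toB6 (geo9K i) Rr Hp) (fun p : SiteY i × ι => blkC i ιB p.1) (fun q : BlkY i × ι => ιB q.1)
      (QcC i par b (.base U)) (fun a a' : IBondY i => (Real.sqrt (Fintype.card ι) * M₂ * ∑ j, ‖b j‖) * (if a = a' then 1 * wcY i a else 0)) := by
  have hQ : QcC i par b (.base U) = conjHom b ((QpY i par U).restrictScalars ℝ) := by rw [QcC, decY_base]
  rw [hQ]
  refine hasL2MajorantHom_conjHom_of_indBound (g := geo9K i) (Rr := Rr) (Hp := Hp) b (blkC i ιB) ιB hM₂ hrepr _ _ (fun a a' => ?_) fun J E y y' hE hJ => ?_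
  · split_ifs
    · exact mul_nonneg zero_le_one (wcY_nonneg i a)
    · exact le_rfl
  · exact l2_indOf_le_of_blockAvg i ιB hι zero_le_one (fun Λ s => by
      rw [LinearMap.restrictScalars_apply, one_mul]; exact norm_QpY_apply_le_sum i par hparU Λ s) J E y y' hE hJ

/-- ★★ **(3.24) IN BLOCK-`ℓ²`, TWO CARRIERS: `QcsC (base U) ≺₂ c_L·𝟙[a = a′]·w_s(a)`** from the block carrier to the site carrier, at a base with contractive
site transporters. [cite: Balaban1985BackgroundPropagators, (3.24)–(3.25) p.395; Balaban1984PropagatorsII, (2.16) p.225, Prop. 2.6 (2.141) p.247] -/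
theorem hasL2MajorantHom_QcsC (hι : ∀ s : BlkY i, β i.hN i.D i.hk (ιB s) = s) {M₂ : ℝ} (hM₂ : 0 ≤ M₂)
    (hrepr : ∀ (v : 𝔸) (j : ι), |b.repr v j| ≤ M₂ * ‖v‖) {U : CfgY 𝔸 i}
    (hparU : ∀ z w : SiteY i, ‖(par U z w : 𝔸)‖ ≤ 1 ∧ ‖(((par U z w)⁻¹ : 𝔸ˣ) : 𝔸)‖ ≤ 1) :
    HasL2MajorantHom (g := toB6 (geo9K i) Rr Hp) (fun q : BlkY i × ι => ιB q.1) (fun p : SiteY i × ι => blkC i ιB p.1)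
      (QcsC i par b (.base U)) (fun a a' : IBondY i => (Real.sqrt (Fintype.card ι) * M₂ * ∑ j, ‖b j‖) * (if a = a' then 1 * wsY i a else 0)) := by
  have hQ : QcsC i par b (.base U) = conjHom b ((QpsY i par U).restrictScalars ℝ) := by rw [QcsC, decY_base]
  rw [hQ]
  refine hasL2MajorantHom_conjHom_of_indBound (g := geo9K i) (Rr := Rr) (Hp := Hp) b ιB (blkC i ιB) hM₂ hrepr _ _ (fun a a' => ?_) fun J E y y' hE hJ => ?_
  · split_ifs
    · exact mul_nonneg zero_le_one (wsY_nonneg i a)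
    · exact le_rfl
  · exact l2_indOf_le_of_blockExt i ιB hι zero_le_one (fun Λ z => by
      rw [LinearMap.restrictScalars_apply, QpsY_apply, one_mul, blkY_apply]
      have h12 : ‖(qpT i par U (blkOf i.D.toDomains z) z : 𝔸)‖ ≤ 1 ∧ ‖(((qpT i par U (blkOf i.D.toDomains z) z)⁻¹ : 𝔸ˣ) : 𝔸)‖ ≤ 1 := hparU _ _
      exact norm_R_le_of_unit _ _ ⟨h12.2, by rw [inv_inv]; exact h12.1⟩) J E y y' hE hJ

/-- ★★ **(3.57)∕(3.59) IN BLOCK-`ℓ²`, TWO CARRIERS: `FcC (base U) (mult a) ≺₂ c_L·(c_var β′)·𝟙[a = a′]·w_c(a)`** under the site-transporter variation law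
`VarParY` at `(U, a)`. [cite: Balaban1985BackgroundPropagators, (3.57) p.401, (3.59) p.402; Balaban1984PropagatorsII, Prop. 2.6 (2.141) p.247] -/
theorem hasL2MajorantHom_FcC (hι : ∀ s : BlkY i, β i.hN i.D i.hk (ιB s) = s) {M₂ : ℝ} (hM₂ : 0 ≤ M₂)
    (hrepr : ∀ (v : 𝔸) (j : ι), |b.repr v j| ≤ M₂ * ‖v‖) {U : CfgY 𝔸 i} {a : AfldY 𝔸 i} {cVar β' : ℝ} (hcv : 0 ≤ cVar * β')
    (hvar : VarParY i par cVar β' U a) :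
    HasL2MajorantHom (g := toB6 (geo9K i) Rr Hp) (fun p : SiteY i × ι => blkC i ιB p.1) (fun q : BlkY i × ι => ιB q.1)
      (FcC i par b (.base U) (.mult a))
      (fun y y' : IBondY i => (Real.sqrt (Fintype.card ι) * M₂ * ∑ j, ‖b j‖) * (if y = y' then cVar * β' * wcY i y else 0)) := by
  classical
  set W' := decY i (.prod U a) with hW'
  have hQ : FcC i par b (.base U) (.mult a) = conjHom b ((QpY i par W' - QpY i par U).restrictScalars ℝ) := by
    rw [FcC, QcC, QcC, decY_base, ← B9Eq376POneLetters.conjHom_sub]; rfl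
  rw [hQ]
  refine hasL2MajorantHom_conjHom_of_indBound (g := geo9K i) (Rr := Rr) (Hp := Hp) b (blkC i ιB) ιB hM₂ hrepr _ _ (fun y y' => ?_) fun J E y y' hE hJ => ?_
  · split_ifs
    · exact mul_nonneg hcv (wcY_nonneg i y)
    · exact le_rfl
  · refine l2_indOf_le_of_blockAvg i ιB hι hcv (fun Λ s => ?_) J E y y' hE hJ
    rw [LinearMap.restrictScalars_apply, LinearMap.sub_apply, Pi.sub_apply, QpY_sub_apply, Finset.mul_sum]
    refine (norm_sum_le _ _).trans (Finset.sum_le_sum fun z _ => ?_)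
    by_cases hq : qpK i s z = 0
    · rw [hq, Complex.ofReal_zero, zero_smul, norm_zero, abs_zero, zero_mul, mul_zero]
    · rw [norm_smul, Complex.norm_real, Real.norm_eq_abs]
      have hz : blkY i z = s := by rw [blkY_apply]; exact qpK_ne_zero_imp i hq
      calc |qpK i s z| * ‖R (qpT i par W' s z) (Λ z) - R (qpT i par U s z) (Λ z)‖
          ≤ |qpK i s z| * (cVar * β' * ‖Λ z‖) := mul_le_mul_of_nonneg_left (hvar s z hz (Λ z)).1 (abs_nonneg _)
        _ = cVar * β' * (|qpK i s z| * ‖Λ z‖) := by ring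

/-- ★★ **(3.57)∕(3.59) IN BLOCK-`ℓ²`, TWO CARRIERS: `FcsC (base U) (mult a) ≺₂ c_L·(c_var β′)·𝟙[a = a′]·w_s(a)`** under `VarParY` at `(U, a)`.
[cite: Balaban1985BackgroundPropagators, (3.57) p.401, (3.59) p.402; Balaban1984PropagatorsII, Prop. 2.6 (2.141) p.247] -/
theorem hasL2MajorantHom_FcsC (hι : ∀ s : BlkY i, β i.hN i.D i.hk (ιB s) = s) {M₂ : ℝ} (hM₂ : 0 ≤ M₂)
    (hrepr : ∀ (v : 𝔸) (j : ι), |b.repr v j| ≤ M₂ * ‖v‖) {U : CfgY 𝔸 i} {a : AfldY 𝔸 i} {cVar β' : ℝ} (hcv : 0 ≤ cVar * β')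
    (hvar : VarParY i par cVar β' U a) :
    HasL2MajorantHom (g := toB6 (geo9K i) Rr Hp) (fun q : BlkY i × ι => ιB q.1) (fun p : SiteY i × ι => blkC i ιB p.1)
      (FcsC i par b (.base U) (.mult a))
      (fun y y' : IBondY i => (Real.sqrt (Fintype.card ι) * M₂ * ∑ j, ‖b j‖) * (if y = y' then cVar * β' * wsY i y else 0)) := by
  classical
  set W' := decY i (.prod U a) with hW'
  have hQ : FcsC i par b (.base U) (.mult a) = conjHom b ((QpsY i par W' - QpsY i par U).restrictScalars ℝ) := by
    rw [FcsC, QcsC, QcsC, decY_base, ← B9Eq376POneLetters.conjHom_sub]; rfl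
  rw [hQ]
  refine hasL2MajorantHom_conjHom_of_indBound (g := geo9K i) (Rr := Rr) (Hp := Hp) b ιB (blkC i ιB) hM₂ hrepr _ _ (fun y y' => ?_) fun J E y y' hE hJ => ?_
  · split_ifs
    · exact mul_nonneg hcv (wsY_nonneg i y)
    · exact le_rfl
  · refine l2_indOf_le_of_blockExt i ιB hι hcv (fun Λ z => ?_) J E y y' hE hJ
    rw [LinearMap.restrictScalars_apply, LinearMap.sub_apply, Pi.sub_apply, QpsY_apply, QpsY_apply]
    have hz : blkY i z = blkOf i.D.toDomains z := blkY_apply i z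
    rw [← hz]
    exact (hvar (blkY i z) z rfl (Λ (blkY i z))).2

end Readings

end Literature.MathematicalPhysics.QuantumFieldTheory.Balaban1983to89.B9SectBKerLettersL2Y

end
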